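import Summits.QuantumFields.YangMills.Theorems.LuscherReductionRunningReductionPolyakovLine
import Summits.QuantumFields.YangMills.Theorems.LuscherReductionRunningReductionConstLift
import HarnessLib

/-!
# The comb tree gauge on `(ℤ/L)³` (sub-stub C4a of the fixed-lattice programme COARSE(L₀) — route `LuscherReduction`, crux RED
# stmt-QuantumFields-19978 KT-door 3b′ / crux `TwistedTraceScaling` stmt-QuantumFields-20203 S-BASE; design note
# `pub/ym-fleet/ym-luscher-20007-p1/COARSE-DESIGN.md` §4 brick (ii))

Coordinates for the INNER Born–Oppenheimer analysis: a complete axial ("comb") gauge fixing on the spatial torus.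
* `treeEdge e` — the comb spanning tree rooted at `0` (`L³ − 1` edges): all direction-`2` links except the wrap-around ones (`x₂ ≠ −1`), the
  direction-`1` links of the plane `x₂ = 0` except wrap-around, the direction-`0` links of the line `x₁ = x₂ = 0` except wrap-around;
* `treeGauge U x = P₀(x₀) · P₁(x₀; x₁) · P₂(x₀,x₁; x₂)` — the parallel transporter from `0` to `x` along the comb (three partial Polyakov lines,
  `lineProd` of the previous file), and `treeFix U = (treeGauge U) · U`;
* ★ `treeFix_eq_one_of_treeEdge` — in the comb gauge every tree link is `1`;
* `eq_of_isPhys_treeFix` — a gauge-invariant function is determined by its values on comb-gauge configurations: `ψ U = ψ (treeFix U)`;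
* `treeGauge_congr` — the transporter only reads TREE links (so that, in the next file, `U ↦ treeFix U` pushes the a-priori measure forward to
  "tree links frozen at `1`, the other `2L³ + 1` links Haar" — the unit Faddeev–Popov determinant of axial gauges);
* continuity / measurability of `treeGauge`, `treeFix`.
HONEST FRAMING: lattice bookkeeping on a fixed lattice; femto rung R2b1; not a gap, not infinite volume, not Clay.
-/

set_option autoImplicit false

noncomputable section

open MeasureTheory Filter Topology Real
open scoped Matrix ComplexConjugate BigOperators
open Literature.MathematicalPhysics.QuantumFieldTheory
open Literature.MathematicalPhysics.QuantumLattice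

namespace Summit.QuantumFields.YangMills.Theorems.FemtoTransferGap

variable {L : ℕ} [NeZero L]

/-! ## §1 Site bookkeeping -/

/-- The foot of `x` in the plane `x₂ = 0`: `(x₀, x₁, 0)`. [folklore] -/
def base2 (x : Site 3 L) : Site 3 L := Function.update x 2 0

/-- The foot of `x` on the line `x₁ = x₂ = 0`: `(x₀, 0, 0)`. [folklore] -/
def base1 (x : Site 3 L) : Site 3 L := Pi.single 0 (x 0)

omit [NeZero L] in
/-- `base2 x` coordinatewise. [folklore] -/
theorem base2_apply (x : Site 3 L) (j : Fin 3) : base2 x j = if j = 2 then 0 else x j := by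
  unfold base2
  by_cases h : j = 2
  · subst h; simp
  · rw [Function.update_of_ne h, if_neg h]

omit [NeZero L] in
/-- `base1 x` coordinatewise. [folklore] -/
theorem base1_apply (x : Site 3 L) (j : Fin 3) : base1 x j = if j = 0 then x 0 else 0 := by
  unfold base1
  by_cases h : j = 0
  · subst h; simp
  · rw [Pi.single_apply]

omit [NeZero L] in
/-- `x = base2 x + x₂ ê₂`. [folklore] -/
theorem base2_add_single (x : Site 3 L) : base2 x + Pi.single 2 (x 2) = x := by
  funext j
  rw [Pi.add_apply, base2_apply, Pi.single_apply]
  by_cases h : j = 2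
  · subst h; simp
  · simp [h]

omit [NeZero L] in
/-- `base2 x = base1 x + x₁ ê₁`. [folklore] -/
theorem base1_add_single (x : Site 3 L) : base1 x + Pi.single 1 (x 1) = base2 x := by
  funext j
  rw [Pi.add_apply, base1_apply, base2_apply, Pi.single_apply]
  fin_cases j <;> simp

omit [NeZero L] in
/-- `base1 x = 0 + x₀ ê₀`. [folklore] -/
theorem zero_add_single (x : Site 3 L) : (0 : Site 3 L) + Pi.single 0 (x 0) = base1 x := by
  rw [zero_add]; rfl

omit [NeZero L] in
/-- A residue is the cast of its value. [folklore] -/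
theorem natCast_val_eq (a : ZMod L) [NeZero L] : ((a.val : ℕ) : ZMod L) = a := ZMod.natCast_zmod_val a

omit [NeZero L] in
/-- `j ↦ (j : ZMod L)` misses `−1` below `L − 1`: if `j + 1 < L` then `(j : ZMod L) ≠ −1`. [folklore] -/
theorem natCast_ne_neg_one_of_lt {j : ℕ} (hj : j + 1 < L) : ((j : ℕ) : ZMod L) ≠ -1 := by
  intro h
  have h1 : (((j + 1 : ℕ) : ℕ) : ZMod L) = 0 := by push_cast; rw [h]; ring
  have h2 : (((j + 1 : ℕ) : ℕ) : ZMod L).val = j + 1 := by rw [ZMod.val_natCast, Nat.mod_eq_of_lt hj]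
  rw [h1, ZMod.val_zero] at h2
  omega

/-- Below the value of a residue there is no wrap-around: `j < a.val ⇒ (j : ZMod L) ≠ −1`. [folklore] -/
theorem natCast_ne_neg_one_of_lt_val {j : ℕ} {a : ZMod L} (hj : j < a.val) : ((j : ℕ) : ZMod L) ≠ -1 :=
  natCast_ne_neg_one_of_lt (by have := ZMod.val_lt a; omega)

/-! ## §2 The comb tree -/

/-- **The comb spanning tree rooted at `0`** (as a Boolean predicate on positively oriented edges): direction `2`: all links with `x₂ ≠ −1`;
direction `1`: links with `x₂ = 0`, `x₁ ≠ −1`; direction `0`: links with `x₁ = x₂ = 0`, `x₀ ≠ −1`.  (`L³ − 1` edges.) [cite: SeilerLNP1982, §2] -/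
def treeEdge (e : Edge 3 L) : Bool :=
  (decide (e.2 = 2) && decide (e.1 2 ≠ -1)) || (decide (e.2 = 1) && decide (e.1 2 = 0) && decide (e.1 1 ≠ -1)) ||
    (decide (e.2 = 0) && decide (e.1 1 = 0) && decide (e.1 2 = 0) && decide (e.1 0 ≠ -1))

omit [NeZero L] in
/-- The three kinds of tree edges. [folklore] -/
theorem treeEdge_iff (e : Edge 3 L) : treeEdge e = true ↔
    (e.2 = 2 ∧ e.1 2 ≠ -1) ∨ (e.2 = 1 ∧ e.1 2 = 0 ∧ e.1 1 ≠ -1) ∨ (e.2 = 0 ∧ e.1 1 = 0 ∧ e.1 2 = 0 ∧ e.1 0 ≠ -1) := by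
  unfold treeEdge
  simp only [Bool.or_eq_true, Bool.and_eq_true, decide_eq_true_eq]
  tauto

/-- Direction-`2` tree edges: `(y + j ê₂, 2)` with `y₂ = 0`, `j < a.val`. [folklore] -/
theorem treeEdge_two {y : Site 3 L} (hy : y 2 = 0) {j : ℕ} {a : ZMod L} (hj : j < a.val) :
    treeEdge ((y + Pi.single 2 ((j : ℕ) : ZMod L), (2 : Fin 3)) : Edge 3 L) = true := by
  rw [treeEdge_iff]
  refine Or.inl ⟨rfl, ?_⟩
  dsimp only
  rw [Pi.add_apply, Pi.single_eq_same, hy, zero_add]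
  exact natCast_ne_neg_one_of_lt_val hj

/-- Direction-`1` tree edges: `(y + j ê₁, 1)` with `y₁ = y₂ = 0`, `j < a.val`. [folklore] -/
theorem treeEdge_one {y : Site 3 L} (hy1 : y 1 = 0) (hy2 : y 2 = 0) {j : ℕ} {a : ZMod L} (hj : j < a.val) :
    treeEdge ((y + Pi.single 1 ((j : ℕ) : ZMod L), (1 : Fin 3)) : Edge 3 L) = true := by
  rw [treeEdge_iff]
  refine Or.inr (Or.inl ⟨rfl, ?_, ?_⟩)
  · dsimp only
    rw [Pi.add_apply, Pi.single_apply, if_neg (by decide), hy2, add_zero]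
  · dsimp only
    rw [Pi.add_apply, Pi.single_eq_same, hy1, zero_add]
    exact natCast_ne_neg_one_of_lt_val hj

/-- Direction-`0` tree edges: `(0 + j ê₀, 0)` with `j < a.val`. [folklore] -/
theorem treeEdge_zero {j : ℕ} {a : ZMod L} (hj : j < a.val) :
    treeEdge (((0 : Site 3 L) + Pi.single 0 ((j : ℕ) : ZMod L), (0 : Fin 3)) : Edge 3 L) = true := by
  rw [treeEdge_iff]
  refine Or.inr (Or.inr ⟨rfl, ?_, ?_, ?_⟩)
  · dsimp only
    rw [Pi.add_apply, Pi.zero_apply, Pi.single_apply, if_neg (by decide), add_zero]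
  · dsimp only
    rw [Pi.add_apply, Pi.zero_apply, Pi.single_apply, if_neg (by decide), add_zero]
  · dsimp only
    rw [Pi.add_apply, Pi.zero_apply, Pi.single_eq_same, zero_add]
    exact natCast_ne_neg_one_of_lt_val hj

/-! ## §3 The transporter along the comb and the comb gauge -/

/-- **Comb transporter** `treeGauge U x = P₀(x₀) · P₁(x₀; x₁) · P₂(x₀, x₁; x₂)`: the product of the links along the comb path from `0` to `x`
(`x₀.val` steps in direction `0`, then `x₁.val` in direction `1`, then `x₂.val` in direction `2`). [cite: SeilerLNP1982, §2] -/
def treeGauge (U : GaugeConfig 3 L SU2) (x : Site 3 L) : SU2 :=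
  lineProd U 0 0 (x 0).val * lineProd U (base1 x) 1 (x 1).val * lineProd U (base2 x) 2 (x 2).val

/-- **Comb gauge** `treeFix U = (treeGauge U) · U`. [cite: SeilerLNP1982, §2] -/
def treeFix (U : GaugeConfig 3 L SU2) : GaugeConfig 3 L SU2 := gaugeTransform (treeGauge U) U

omit [NeZero L] in
/-- The transporter starts at `1`. [folklore] -/
theorem treeGauge_zero (U : GaugeConfig 3 L SU2) : treeGauge U 0 = 1 := by
  unfold treeGauge
  simp [ZMod.val_zero, base1, base2]

/-- Transport along a direction-`2` tree edge: `h(x + ê₂) = h(x) · U(x,2)` (`x₂ ≠ −1`). [folklore] -/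
theorem treeGauge_shift_two (U : GaugeConfig 3 L SU2) {x : Site 3 L} (hx : x 2 ≠ -1) :
    treeGauge U (x.shift 2) = treeGauge U x * U (x, 2) := by
  have h0 : (x.shift 2) 0 = x 0 := by rw [Site.shift, Pi.add_apply, Pi.single_apply, if_neg (by decide), add_zero]
  have h1 : (x.shift 2) 1 = x 1 := by rw [Site.shift, Pi.add_apply, Pi.single_apply, if_neg (by decide), add_zero]
  have h2 : (x.shift 2) 2 = x 2 + 1 := by rw [Site.shift, Pi.add_apply, Pi.single_eq_same]
  have hb1 : base1 (x.shift 2) = base1 x := by unfold base1; rw [h0]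
  have hb2 : base2 (x.shift 2) = base2 x := by
    funext j; rw [base2_apply, base2_apply]
    by_cases hj : j = 2
    · rw [if_pos hj, if_pos hj]
    · rw [if_neg hj, if_neg hj, Site.shift, Pi.add_apply, Pi.single_apply, if_neg hj, add_zero]
  have hval : (x 2 + 1).val = (x 2).val + 1 := zmod_val_add_one_of_ne hx
  unfold treeGauge
  rw [h0, h1, h2, hb1, hb2, hval, lineProd_succ, natCast_val_eq, base2_add_single, ← mul_assoc]

/-- Transport along a direction-`1` tree edge: `h(x + ê₁) = h(x) · U(x,1)` (`x₂ = 0`, `x₁ ≠ −1`). [folklore] -/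
theorem treeGauge_shift_one (U : GaugeConfig 3 L SU2) {x : Site 3 L} (hx2 : x 2 = 0) (hx1 : x 1 ≠ -1) :
    treeGauge U (x.shift 1) = treeGauge U x * U (x, 1) := by
  have h0 : (x.shift 1) 0 = x 0 := by rw [Site.shift, Pi.add_apply, Pi.single_apply, if_neg (by decide), add_zero]
  have h1 : (x.shift 1) 1 = x 1 + 1 := by rw [Site.shift, Pi.add_apply, Pi.single_eq_same]
  have h2 : (x.shift 1) 2 = 0 := by rw [Site.shift, Pi.add_apply, Pi.single_apply, if_neg (by decide), add_zero, hx2]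
  have hb1 : base1 (x.shift 1) = base1 x := by unfold base1; rw [h0]
  have hbx : base2 x = x := by
    funext j; rw [base2_apply]
    by_cases hj : j = 2
    · rw [if_pos hj, hj, hx2]
    · rw [if_neg hj]
  have hval : (x 1 + 1).val = (x 1).val + 1 := zmod_val_add_one_of_ne hx1
  unfold treeGauge
  rw [h0, h1, h2, hb1, hval, hx2, ZMod.val_zero, lineProd_zero, lineProd_zero, mul_one, mul_one, lineProd_succ, natCast_val_eq,
    base1_add_single, hbx, ← mul_assoc]

/-- Transport along a direction-`0` tree edge: `h(x + ê₀) = h(x) · U(x,0)` (`x₁ = x₂ = 0`, `x₀ ≠ −1`). [folklore] -/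
theorem treeGauge_shift_zero (U : GaugeConfig 3 L SU2) {x : Site 3 L} (hx1 : x 1 = 0) (hx2 : x 2 = 0) (hx0 : x 0 ≠ -1) :
    treeGauge U (x.shift 0) = treeGauge U x * U (x, 0) := by
  have h0 : (x.shift 0) 0 = x 0 + 1 := by rw [Site.shift, Pi.add_apply, Pi.single_eq_same]
  have h1 : (x.shift 0) 1 = 0 := by rw [Site.shift, Pi.add_apply, Pi.single_apply, if_neg (by decide), add_zero, hx1]
  have h2 : (x.shift 0) 2 = 0 := by rw [Site.shift, Pi.add_apply, Pi.single_apply, if_neg (by decide), add_zero, hx2]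
  have hx : base1 x = x := by
    funext j; rw [base1_apply]
    fin_cases j
    · simp
    · simp [hx1]
    · simp [hx2]
  have hval : (x 0 + 1).val = (x 0).val + 1 := zmod_val_add_one_of_ne hx0
  unfold treeGauge
  rw [h0, h1, h2, hx1, hx2, hval, ZMod.val_zero, lineProd_zero, lineProd_zero, lineProd_zero, lineProd_zero, mul_one, mul_one, mul_one,
    mul_one, lineProd_succ, natCast_val_eq, zero_add_single, hx]

/-- ★ **In the comb gauge every tree link is `1`.** [cite: SeilerLNP1982, §2] -/
theorem treeFix_eq_one_of_treeEdge (U : GaugeConfig 3 L SU2) {e : Edge 3 L} (he : treeEdge e = true) : treeFix U e = 1 := by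
  obtain ⟨x, k⟩ := e
  rw [treeEdge_iff] at he
  unfold treeFix gaugeTransform
  simp only
  rcases he with ⟨hk, hx⟩ | ⟨hk, hx2, hx1⟩ | ⟨hk, hx1, hx2, hx0⟩
  · simp only at hk; subst hk
    rw [treeGauge_shift_two U hx, mul_inv_rev, ← mul_assoc, mul_inv_cancel_right, mul_inv_cancel]
  · simp only at hk; subst hk
    rw [treeGauge_shift_one U hx2 hx1, mul_inv_rev, ← mul_assoc, mul_inv_cancel_right, mul_inv_cancel]
  · simp only at hk; subst hk
    rw [treeGauge_shift_zero U hx1 hx2 hx0, mul_inv_rev, ← mul_assoc, mul_inv_cancel_right, mul_inv_cancel]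

omit [NeZero L] in
/-- A gauge-invariant function takes the same value on `U` and on its comb-gauge representative. [folklore] -/
theorem eq_treeFix_of_gaugeInvariant {α : Type*} {ψ : GaugeConfig 3 L SU2 → α}
    (hψ : ∀ (g : Site 3 L → SU2) (U : GaugeConfig 3 L SU2), ψ (gaugeTransform g U) = ψ U) (U : GaugeConfig 3 L SU2) :
    ψ (treeFix U) = ψ U :=
  hψ _ U

omit [NeZero L] in
/-- In particular for physical zero-flux test functions. [folklore] -/
theorem eq_treeFix_of_isPhys {ψ : GaugeConfig 3 L SU2 → ℝ} (hψ : IsPhys ψ) (U : GaugeConfig 3 L SU2) : ψ (treeFix U) = ψ U :=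
  hψ.gaugeInv _ U

/-! ## §4 The transporter reads only tree links -/

omit [NeZero L] in
/-- Two configurations agreeing on the links of a line give the same partial line. [folklore] -/
theorem lineProd_congr {U U' : GaugeConfig 3 L SU2} {x : Site 3 L} {k : Fin 3} {n : ℕ}
    (h : ∀ j : ℕ, j < n → U (x + Pi.single k ((j : ℕ) : ZMod L), k) = U' (x + Pi.single k ((j : ℕ) : ZMod L), k)) :
    lineProd U x k n = lineProd U' x k n := by
  induction n with
  | zero => rfl
  | succ n ih =>
    rw [lineProd_succ, lineProd_succ, ih (fun j hj => h j (Nat.lt_succ_of_lt hj)), h n (Nat.lt_succ_self n)]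

/-- ★ **The comb transporter depends only on the tree links**: configurations agreeing on the comb tree have the same transporter.
[cite: SeilerLNP1982, §2] -/
theorem treeGauge_congr {U U' : GaugeConfig 3 L SU2} (h : ∀ e : Edge 3 L, treeEdge e = true → U e = U' e) (x : Site 3 L) :
    treeGauge U x = treeGauge U' x := by
  unfold treeGauge
  have hb1 : ∀ j : Fin 3, j ≠ 0 → base1 x j = 0 := fun j hj => by rw [base1_apply, if_neg hj]
  rw [lineProd_congr (U' := U') (fun j hj => h _ (treeEdge_zero hj)),
    lineProd_congr (U' := U') (x := base1 x) (fun j hj => h _ (treeEdge_one (hb1 1 (by decide)) (hb1 2 (by decide)) hj)),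
    lineProd_congr (U' := U') (x := base2 x) (fun j hj => h _ (treeEdge_two (by rw [base2_apply, if_pos rfl]) hj))]

/-! ## §5 Continuity and measurability -/

omit [NeZero L] in
/-- Partial lines are continuous in the configuration. [folklore] -/
theorem continuous_lineProd (x : Site 3 L) (k : Fin 3) (n : ℕ) : Continuous fun U : GaugeConfig 3 L SU2 => lineProd U x k n := by
  induction n with
  | zero => simp only [lineProd_zero]; exact continuous_const
  | succ n ih => simp only [lineProd_succ]; exact ih.mul (continuous_apply _)

omit [NeZero L] in
/-- The comb transporter is continuous in the configuration. [folklore] -/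
theorem continuous_treeGauge (x : Site 3 L) : Continuous fun U : GaugeConfig 3 L SU2 => treeGauge U x := by
  unfold treeGauge
  exact ((continuous_lineProd _ _ _).mul (continuous_lineProd _ _ _)).mul (continuous_lineProd _ _ _)

omit [NeZero L] in
/-- The comb gauge map `U ↦ treeFix U` is continuous. [folklore] -/
theorem continuous_treeFix : Continuous (treeFix (L := L)) := by
  refine continuous_pi fun e => ?_
  unfold treeFix gaugeTransform
  exact ((continuous_treeGauge e.1).mul (continuous_apply e)).mul (continuous_treeGauge _).inv

/-- The comb gauge map is measurable. [folklore] -/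
theorem measurable_treeFix : Measurable (treeFix (L := L)) := by
  haveI : SecondCountableTopology SU2 := secondCountableTopology_su2
  exact continuous_treeFix.measurable

end Summit.QuantumFields.YangMills.Theorems.FemtoTransferGap

end
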